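import Summits.KontsevichZagierPeriods.KontsevichZagierPeriods.Theses.FurushoPentagon
import Summits.KontsevichZagierPeriods.KontsevichZagierPeriods.Theorems.ReducedPeriodRing.Negative.RingForms
import Literature.NumberTheory.Transcendental.KZRulesAssociator

/-!
# `ReducedPeriodRing` (stmt-KontsevichZagierPeriods-3929) — load-bearing anatomy of the picked line

The registered skeleton for this crux (line `cartier-pullback-nilpotents-are-pi-torsion`, sharpened
form of TRIAGE-r1-2; stubs `CubeCompilation`, `CubeProduct`, `StokesCalibration`,
`MovesAreStokesModPi`, `AyoubLocalisedReduced`, `PiCalibration`, `PiCancellation`) has the abstract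
shape: a ring homomorphism `Φ : A → P` (`A` = Ayoub's real effective ring of algebraic germs on
closed cubes modulo the real Stokes elements — `CubeProduct` + `StokesCalibration` make `Φ` a
well-defined ring map) which is SURJECTIVE (`CubeCompilation`), whose kernel is `t`-power torsion
for a distinguished `t ∈ A` (`MovesAreStokesModPi`), with `A[1/t]` reduced
(`AyoubLocalisedReduced`) and `Φ t` = the disc class `⟦π⟧` (`PiCalibration`) regular in `P`
(`PiCancellation`, item 0540). This file certifies, as pure commutative algebra:

* the transfer is VALID: the four abstract inputs give `IsReduced P` (`isReduced_of_transfer`), and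
  without regularity they give exactly "nilpotents of `P` are `Φ t`-power torsion"
  (`nil_torsion_of_transfer`) — the line's `C⁺`;
* EVERY input is load-bearing: dropping any one of surjectivity / kernel control / localised
  reducedness / regularity admits a non-reduced `P` (`transfer_needs_surjective`,
  `transfer_needs_kernel_control`, `transfer_needs_localised_reduced`, `transfer_needs_regular`).
  So the lead cannot bypass any of the stubs `CubeCompilation`, `MovesAreStokesModPi`,
  `AyoubLocalisedReduced`, `PiCancellation` by commutative algebra;
* applied to `R = KZ.FormalPeriodRing`, `isReduced_of_transfer` plus `reducedPeriodRing_iff_isReduced`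
  (`Negative/RingForms.lean`) is the line's deciding step (spelled out in the crux workfile
  `Cruxes/ReducedPeriodRing/Disproof.lean`, `reducedPeriodRing_of_transfer`).
Plus one more independence model for the sibling shadow "`P` is a domain": a DOMAIN with a
surjective but non-injective evaluation character (`ℝ[X] → ℝ`, `domain_model_not_injective`), so
even "no zero-divisors" (crux ∧ PiCancellation-for-everything) is abstractly short of the summit.
cdisprove (refuter) file, cycle 2. [Kontsevich–Zagier 2001, §4.1; Ayoub, EMS Newsl. 91 (2014),
Prop. 11; Huber–Müller-Stach 2017, Rem. 13.1.8]
-/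

noncomputable section

namespace Summit.KontsevichZagierPeriods.KontsevichZagierPeriods.ReducedPeriodRingNegative

open Literature.NumberTheory.Transcendental KZ
open Summit.KontsevichZagierPeriods.KontsevichZagierPeriods.Theses.FurushoPentagon

section Transfer

variable {A R : Type*} [CommRing A] [CommRing R]

/-- **The transfer behind the line, without regularity**: a surjective ring map `Φ : A → R` whose
kernel is `t`-power torsion, from a ring whose nilpotents are `t`-power torsion (`⇔ A[1/t]`
reduced), makes every nilpotent of `R` a `Φ t`-power-torsion element. [folklore] -/
theorem nil_torsion_of_transfer (Φ : A →+* R) (t : A) (hsurj : Function.Surjective Φ)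
    (hker : ∀ a : A, Φ a = 0 → ∃ N : ℕ, t ^ N * a = 0)
    (hred : ∀ a : A, IsNilpotent a → ∃ N : ℕ, t ^ N * a = 0)
    (x : R) (hx : IsNilpotent x) : ∃ N : ℕ, Φ t ^ N * x = 0 := by
  obtain ⟨a, rfl⟩ := hsurj x
  obtain ⟨n, hn⟩ := hx
  rw [← map_pow] at hn
  obtain ⟨N, hN⟩ := hker _ hn
  have hnil : IsNilpotent (t ^ N * a) := by
    refine ⟨n + 1, ?_⟩
    calc (t ^ N * a) ^ (n + 1) = (t ^ N) ^ n * (a * (t ^ N * a ^ n)) := by ring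
      _ = 0 := by rw [hN]; ring
  obtain ⟨M, hM⟩ := hred _ hnil
  refine ⟨M + N, ?_⟩
  have := congrArg Φ hM
  rwa [map_mul, map_mul, map_pow, map_pow, map_zero, ← mul_assoc, ← pow_add] at this

/-- **The transfer behind the line**: if moreover `Φ t` is regular in `R`, then `R` is reduced.
[folklore] -/
theorem isReduced_of_transfer (Φ : A →+* R) (t : A) (hsurj : Function.Surjective Φ)
    (hker : ∀ a : A, Φ a = 0 → ∃ N : ℕ, t ^ N * a = 0)
    (hred : ∀ a : A, IsNilpotent a → ∃ N : ℕ, t ^ N * a = 0)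
    (hreg : ∀ y : R, Φ t * y = 0 → y = 0) : IsReduced R := by
  refine ⟨fun x hx => ?_⟩
  obtain ⟨N, hN⟩ := nil_torsion_of_transfer Φ t hsurj hker hred x hx
  induction N with
  | zero => simpa using hN
  | succ N ih => exact ih (hreg _ (by rw [← mul_assoc, ← pow_succ']; exact hN))

/-- The localised-reducedness input in Mathlib's spelling: if `A[1/t]` is reduced then nilpotents
of `A` are `t`-power torsion. [folklore] -/
theorem torsion_of_isReduced_away (t : A) [IsReduced (Localization.Away t)] (a : A)
    (ha : IsNilpotent a) : ∃ N : ℕ, t ^ N * a = 0 := by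
  have h0 : algebraMap A (Localization.Away t) a = 0 :=
    (ha.map (algebraMap A (Localization.Away t))).eq_zero
  rw [IsLocalization.map_eq_zero_iff (Submonoid.powers t)] at h0
  obtain ⟨⟨m, ⟨N, rfl⟩⟩, hm⟩ := h0
  exact ⟨N, by simpa using hm⟩

end Transfer

/-! ### Each input is load-bearing (drop-one models) -/

/-- The dual numbers `ℚ[ε]` are not reduced. [folklore] -/
theorem not_isReduced_dualNumber : ¬ IsReduced (DualNumber ℚ) := by
  intro hred
  have hnil : IsNilpotent (DualNumber.eps : DualNumber ℚ) :=
    ⟨2, by rw [pow_two]; exact DualNumber.eps_mul_eps⟩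
  have h0 := hred.eq_zero _ hnil
  have := congrArg TrivSqZeroExt.snd h0
  simp at this

/-- **`CubeCompilation` (surjectivity) is load-bearing**: `ℚ ↪ ℚ[ε]`, `t = 1` — injective (so
kernel control holds), source reduced, `Φ t = 1` regular, target not reduced. [folklore] -/
theorem transfer_needs_surjective :
    ∃ (A R : Type) (_ : CommRing A) (_ : CommRing R) (Φ : A →+* R) (t : A),
      (∀ a : A, Φ a = 0 → ∃ N : ℕ, t ^ N * a = 0) ∧
      (∀ a : A, IsNilpotent a → ∃ N : ℕ, t ^ N * a = 0) ∧
      (∀ y : R, Φ t * y = 0 → y = 0) ∧ ¬ IsReduced R := by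
  refine ⟨ℚ, DualNumber ℚ, inferInstance, inferInstance, algebraMap ℚ (DualNumber ℚ), 1,
    ?_, ?_, ?_, not_isReduced_dualNumber⟩
  · intro a ha
    have h0 : a = 0 := by
      have h := congrArg TrivSqZeroExt.fst ha
      simpa [TrivSqZeroExt.algebraMap_eq_inl] using h
    exact ⟨0, by simp [h0]⟩
  · intro a ha
    exact ⟨0, by simpa using ha.eq_zero⟩
  · intro y hy
    simpa using hy

/-- **`MovesAreStokesModPi` (kernel control) is load-bearing**: `ℚ[X] ↠ ℚ[ε]`, `X ↦ ε`, `t = 1` —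
surjective, source reduced (a domain), `Φ t = 1` regular, target not reduced; the kernel `(X²)` is
not torsion. [folklore] -/
theorem transfer_needs_kernel_control :
    ∃ (A R : Type) (_ : CommRing A) (_ : CommRing R) (Φ : A →+* R) (t : A),
      Function.Surjective Φ ∧
      (∀ a : A, IsNilpotent a → ∃ N : ℕ, t ^ N * a = 0) ∧
      (∀ y : R, Φ t * y = 0 → y = 0) ∧ ¬ IsReduced R := by
  refine ⟨Polynomial ℚ, DualNumber ℚ, inferInstance, inferInstance,
    (Polynomial.aeval (R := ℚ) (DualNumber.eps : DualNumber ℚ)).toRingHom, 1, ?_, ?_, ?_,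
    not_isReduced_dualNumber⟩
  · intro y
    refine ⟨Polynomial.C y.fst + Polynomial.C y.snd * Polynomial.X, ?_⟩
    change Polynomial.aeval DualNumber.eps (Polynomial.C y.fst + Polynomial.C y.snd * Polynomial.X) = y
    rw [map_add, map_mul, Polynomial.aeval_C, Polynomial.aeval_C, Polynomial.aeval_X]
    ext <;> simp [Algebra.algebraMap_eq_smul_one]
  · intro a ha
    exact ⟨0, by simpa using ha.eq_zero⟩
  · intro y hy
    simpa using hy

/-- **`AyoubLocalisedReduced` is load-bearing**: the identity of `ℚ[ε]`, `t = 1` — surjective,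
kernel control trivial, `Φ t = 1` regular, target not reduced (the source's nilpotent `ε` is not
`1`-power torsion). [folklore] -/
theorem transfer_needs_localised_reduced :
    ∃ (A R : Type) (_ : CommRing A) (_ : CommRing R) (Φ : A →+* R) (t : A),
      Function.Surjective Φ ∧
      (∀ a : A, Φ a = 0 → ∃ N : ℕ, t ^ N * a = 0) ∧
      (∀ y : R, Φ t * y = 0 → y = 0) ∧ ¬ IsReduced R := by
  refine ⟨DualNumber ℚ, DualNumber ℚ, inferInstance, inferInstance, RingHom.id _, 1,
    Function.surjective_id, ?_, ?_, not_isReduced_dualNumber⟩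
  · intro a ha
    exact ⟨0, by simpa using ha⟩
  · intro y hy
    simpa using hy

/-- **`PiCancellation` (regularity of `Φ t`) is load-bearing**: the identity of `ℚ × ℚ[ε]`,
`t = (1, 0)` — surjective, kernel control trivial, nilpotents `(0, bε)` ARE `t`-torsion (so the
localised ring `ℚ` is reduced), yet the target is not reduced: all the weight sits on regularity
of the disc class, exactly as in `piTorsion_model_not_reduced` of the crux workfile. [folklore] -/
theorem transfer_needs_regular :
    ∃ (A R : Type) (_ : CommRing A) (_ : CommRing R) (Φ : A →+* R) (t : A),
      Function.Surjective Φ ∧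
      (∀ a : A, Φ a = 0 → ∃ N : ℕ, t ^ N * a = 0) ∧
      (∀ a : A, IsNilpotent a → ∃ N : ℕ, t ^ N * a = 0) ∧ ¬ IsReduced R := by
  refine ⟨ℚ × DualNumber ℚ, ℚ × DualNumber ℚ, inferInstance, inferInstance, RingHom.id _, (1, 0),
    Function.surjective_id, ?_, ?_, ?_⟩
  · intro a ha
    exact ⟨0, by simpa using ha⟩
  · rintro ⟨a, x⟩ ⟨n, hn⟩
    have ha : a ^ n = 0 := by
      have := congrArg Prod.fst hn
      simpa using this
    have ha0 : a = 0 := pow_eq_zero_iff'.mp ha |>.1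
    refine ⟨1, ?_⟩
    ext <;> simp [ha0]
  · intro hred
    have hnil : IsNilpotent ((0, DualNumber.eps) : ℚ × DualNumber ℚ) :=
      ⟨2, by ext <;> simp [pow_two, DualNumber.eps_mul_eps]⟩
    have h0 := hred.eq_zero _ hnil
    have := congrArg (fun p : ℚ × DualNumber ℚ => TrivSqZeroExt.snd p.2) h0
    simp at this

/-! ### The sibling shadow "no zero-divisors" is also short of the summit, abstractly -/

/-- A DOMAIN with a surjective evaluation character which is NOT injective: `ℝ[X] → ℝ`, `X ↦ 0`.
So "`P` is a domain" (which implies the crux and `PiCancellation` for every non-zero class) does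
not abstractly give the kernel conjecture either. [folklore] -/
theorem domain_model_not_injective :
    ∃ (R : Type) (_ : CommRing R) (_ : IsDomain R) (ev : R →+* ℝ),
      Function.Surjective ev ∧ ¬ Function.Injective ev := by
  refine ⟨Polynomial ℝ, inferInstance, inferInstance, Polynomial.evalRingHom 0, ?_, ?_⟩
  · intro a
    exact ⟨Polynomial.C a, by simp⟩
  · intro hinj
    have h : Polynomial.evalRingHom 0 (Polynomial.X : Polynomial ℝ) = Polynomial.evalRingHom 0 0 := by
      simp
    exact Polynomial.X_ne_zero (hinj h)

end Summit.KontsevichZagierPeriods.KontsevichZagierPeriods.ReducedPeriodRingNegative
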